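import Literature.IUT.LogThetaLattice.GlobalFrobenioidModelsLogVolume
import Literature.IUT.LogThetaLattice.GlobalFrobenioidModelsData
import HarnessLib

/-!
# [IUTchIII] Example 3.6 / Proposition 3.7 (i)(ii) at the model places of a number field: the standing
# hypotheses `ModelHyps` HOLD, so `𝓕⊛_𝔪𝔬𝔡 ≌ ModelFrobenioid` is unconditional there

Proof-only companion (abc-iut cell, layer L6, D-0067 wave-4 discharge seat abc-iut-w4-d005, board row F10-a =
[IUTchIII] Prop. 3.7 (i)(ii)) of abc-iut-L6-t6's `GlobalFrobenioidModelsCategory.lean` /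
`GlobalFrobenioidModelsData.lean` and abc-iut-L6-d1's `GlobalFrobenioidModelsPlaces.lean`. NO new definitions.

S. Mochizuki, *Inter-universal Teichmüller Theory III*, kurims manuscript (May 2020), Example 3.6 (i)(ii)
pp. 107–108 and Proposition 3.7 (i)(ii) pp. 109–110 [claim key Mochizuki2012, status disputed (D-0012)]:
Prop. 3.7 (i)(ii) construct, "as discussed in Example 3.6, (i) [(ii)]", the Frobenioids `(†𝓕⊛_MOD)_α`,
`(†𝓕⊛_𝔪𝔬𝔡)_α` from the NUMBER FIELD `(†𝕄⊛_MOD)_α = (†𝕄⊛_𝔪𝔬𝔡)_α` (the image of the localization homomorphism of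
Prop. 3.3) and its local data at the places `v ∈ 𝕍` (Ex. 3.6 (i): "the valuation on `K_v` determined by `v`
determines a group homomorphism `β_v : F^×_mod → K^×_v/𝒪^×_{K_v}`").

abc-iut-L6-t6 constructed the category `𝓕⊛_𝔪𝔬𝔡` (`FrakCat`) over ABSTRACT local data
`(V, Γ_v ⊇ Γ_v^{≥0}, β_v)` and proved `𝓕⊛_𝔪𝔬𝔡 ≌ ModelFrobenioid(𝒟, Φ, 𝔹, Div_𝔹)` ([FrdI] Thm. 5.2 model; the
tree's form of "`𝓕⊛_mod ≅ 𝓕⊛_𝔪𝔬𝔡` inducing the identity on `F^×_mod`", `unit_toModel_map`) UNDER the standing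
hypotheses `ModelHyps nonneg β` (every class a difference of nonnegative ones; `Γ_v^{≥0}` saturated and sharp;
every `f ∈ F^×_mod` a `v`-unit at almost all `v`) — which no file discharges. abc-iut-L6-d1 fixed the MODEL
data of a number field `F` (`ModelPlaces F` = finite ⊔ archimedean places, `Γ_v = ℝ ⊇ ℝ_{≥0}`,
`β_v = ord_v` / `−log |·|_v`: `betaModel`, `nonnegModel`). THIS FILE PROVES `ModelHyps` for that model data
(`modelHyps_places`): the three cone properties are those of `ℝ_{≥0} ⊆ ℝ`, and the finite-support clause is
the classical fact that a nonzero element of a number field is a unit at all but finitely many places —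
abc-iut-L6-d3's `finite_betaModel_ne_zero` (`GlobalFrobenioidModelsLogVolume.lean`), reused by name. CONSEQUENCE (stated, by name): for every number field `(†𝕄⊛_𝔪𝔬𝔡)_α` the comparison
functor `toModel` of its fractional-ideal Frobenioid `(†𝓕⊛_𝔪𝔬𝔡)_α` at the model places IS an equivalence with the
model Frobenioid of `(Φ, F^×, β)` and sends every morphism `(n, f)` to the unit `f` — i.e. the natural
isomorphism "`(†𝓕⊛_mod)_α ⥲ (†𝓕⊛_𝔪𝔬𝔡)_α` that induce[s] the tautological isomorphism `(†𝕄⊛_mod)_α ⥲ (†𝕄⊛_𝔪𝔬𝔡)_α`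
on the associated rational function monoids" (Prop. 3.7 (ii), p. 110 l. 44–48) holds UNCONDITIONALLY at
the model places (`toModel_isEquivalence_places`, `unit_toModel_map_places`).

HONEST SCOPE. `Γ_v = ℝ` at the finite places is abc-iut-L6-d1's REALIFIED reading of `K^×_v/𝒪^×_{K_v} ≅ ℤ`
(the classes `ord_v` land in `ℤ ⊆ ℝ`); the category so obtained is the fractional-ideal Frobenioid with
real coefficients at every place (it contains `𝓕⊛_𝔪𝔬𝔡` and maps to its realification). The categorical
`(†𝓕⊛_MOD)_α` (Ex. 3.6 (i), torsor version) is abc-iut-L6-t6's staged `MODCat` and is NOT used here. Nothing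
in this file takes a side on [IUTchIII] Cor. 3.12; typed ≠ discharged; what is proved is classical
algebraic number theory about the places of a number field.
-/

noncomputable section

namespace Literature.IUT.LogThetaLattice

namespace GlobalFrobenioidModels

open CategoryTheory NumberField IsDedekindDomain Literature.IUT.LogThetaLattice

variable {F : Type} [Field F] [NumberField F]

/-! ### `ModelHyps` at the model places -/

variable (F) in
/-- **The standing hypotheses `ModelHyps` of abc-iut-L6-t6's Frobenioid structure on `𝓕⊛_𝔪𝔬𝔡` HOLD at the
model places of a number field** (`Γ_v = ℝ ⊇ ℝ_{≥0}`, `β_v = ord_v` / `−log |·|_v`): `ℝ_{≥0}` generates `ℝ`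
(`x = max(x,0) − max(−x,0)`), is saturated (`n·x ≥ 0`, `n > 0` ⇒ `x ≥ 0`) and sharp, and every `f ∈ F^×`
is a unit at almost all places. ([IUTchIII] Ex. 3.6 (i)(ii) pp.107–108; Prop. 3.7 (ii) p.110)
[claim: Mochizuki2012, status: disputed] -/
theorem modelHyps_places :
    ModelHyps (F := F) (V := ModelPlaces F) (Γ := fun _ => ℝ) nonnegModel betaModel where
  directed v x := by
    change ℝ at x
    refine ⟨max x 0, ?_, max (-x) 0, ?_, ?_⟩
    · show (0 : ℝ) ≤ max x 0
      exact le_max_right _ _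
    · show (0 : ℝ) ≤ max (-x) 0
      exact le_max_right _ _
    · show x = max x 0 - max (-x) 0
      rcases le_total 0 x with h | h
      · rw [max_eq_left h, max_eq_right (neg_nonpos.mpr h), sub_zero]
      · rw [max_eq_right h, max_eq_left (neg_nonneg.mpr h), zero_sub, neg_neg]
  saturated v x n hn hx := by
    change ℝ at x
    change (0 : ℝ) ≤ n • x at hx
    show (0 : ℝ) ≤ x
    rw [nsmul_eq_mul] at hx
    exact nonneg_of_mul_nonneg_right hx (Nat.cast_pos.mpr hn)
  sharp v x hx hnx := by
    change ℝ at x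
    change (0 : ℝ) ≤ x at hx
    change (0 : ℝ) ≤ -x at hnx
    linarith
  finite f := finite_betaModel_ne_zero f

/-! ### Consequences for Prop. 3.7 (ii) at the model places (by name, from abc-iut-L6-t6's theorems) -/

variable (F) in
/-- **[IUTchIII] Prop. 3.7 (ii) at the model places, first isomorphism**: for a number field
`(†𝕄⊛_𝔪𝔬𝔡)_α = F`, the comparison functor from its fractional-ideal Frobenioid `(†𝓕⊛_𝔪𝔬𝔡)_α` (abc-iut-L6-t6
`FrakCat` at the model places) to the model Frobenioid of `(Φ, F^×, β)` — the tree's `(†𝓕⊛_mod)_α` in [FrdI]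
Thm. 5.2 form — IS an equivalence of categories, with no residual hypothesis ("natural isomorphisms of
Frobenioids `(†𝓕⊛_mod)_α ⥲ (†𝓕⊛_𝔪𝔬𝔡)_α`", p.110 l.44). [claim: Mochizuki2012, status: disputed] -/
theorem toModel_isEquivalence_places :
    (toModel (F := F) (V := ModelPlaces F) (Γ := fun _ => ℝ) (nonneg := nonnegModel) (β := betaModel)
      (modelHyps_places F)).IsEquivalence :=
  toModel_isEquivalence _

variable (F) in
/-- **[IUTchIII] Prop. 3.7 (ii) at the model places, rational-function clause**: the equivalence of
`toModel_isEquivalence_places` "induce[s] the tautological isomorphism `(†𝕄⊛_mod)_α ⥲ (†𝕄⊛_𝔪𝔬𝔡)_α` on the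
associated rational function monoids" — every morphism `(n, f)` of `(†𝓕⊛_𝔪𝔬𝔡)_α` is sent to the morphism of the
model Frobenioid whose unit (rational-function) component is `f` itself (p.110 l.46–48; Ex. 3.6 (ii)
p.108 l.15–17 "induces the identity morphism `F^×_mod → F^×_mod`"). [claim: Mochizuki2012, status: disputed] -/
theorem unit_toModel_map_places
    {X Y : FrakCat F (ModelPlaces F) (fun _ => ℝ) nonnegModel betaModel} (φ : X ⟶ Y) :
    Literature.AlgebraicGeometry.Frobenioids.ModelFrobenioid.unit
        ((toModel (nonneg := nonnegModel) (β := betaModel) (modelHyps_places F)).map φ) =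
      FrakCat.fn φ :=
  unit_toModel_map _ φ

end GlobalFrobenioidModels

end Literature.IUT.LogThetaLattice

end
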